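import Literature.NumberTheory.Automorphic.RelNormOneTorus
import HarnessLib

/-!
# The seesaw torus `T = U(W₁) × U(W₂)` of two hermitian lines and its automorphic quotient

Topic `NumberTheory/Automorphic`; namespace `Literature.NumberTheory.Automorphic` (sub-namespace `SeesawTorus`).

For a finite extension of number fields `L/K` and two hermitian LINES `W₁, W₂` over `L/K` one has canonically
`U(W_j) = U(1)_{L/K}`, the relative norm-one torus (file `RelNormOneTorus`: adelic points `relNormOneIdeles K L`,
rational points `relNormOneRat K L`, compact automorphic quotient `[U(W_j)]`).  The SEESAW TORUS is
`T = U(W₁) × U(W₂) ⊂ U(W₁ ⊕ W₂)`; this file records its adelic points, rational points and automorphic quotient: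

* § 1 `T(𝔸) = SeesawTorus K L := U(W₁)(𝔸_K) × U(W₂)(𝔸_K)` (type synonym: commutative, Hausdorff, locally compact
  topological group with its Borel σ-algebra), projections / inclusions, the rational points
  `T(K) = SeesawTorus.rat K L = U(W₁)(K) × U(W₂)(K)` (discrete, closed);
* § 2 the automorphic quotient `[T] = T(K) \ T(𝔸)` and **`[T] ≃ₜ* [U(W₁)] × [U(W₂)]`** (`SeesawTorus.quotEquiv`), whence
  `[T]` is COMPACT; its Haar probability measure `SeesawTorus.probHaarQuot` (unique) and a Haar measure on `T(𝔸)`.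

Everything is proved (Mathlib + tree); no named facts.  Port to the tree idele library of the HodgeCM publication
cell's `PerL34/SeesawTorus` §§ 3–5 (2026-08-18), minus the fundamental-domain statements.

References: V. Platonov, A. Rapinchuk, *Algebraic Groups and Number Theory* (1994), § 5.3 (compactness of
`T(K) \ T(𝔸)` for anisotropic tori) [cite: PlatonovRapinchuk1994, §5.3]; R. Godement, *Domaines fondamentaux des
groupes arithmétiques*, Sém. Bourbaki 257 (1962/63), § 5 Thm. 4 [cite: Godement1964, §5 Thm. 4].
-/

set_option autoImplicit false

noncomputable section

open _root_.MeasureTheory _root_.Topology _root_.Set _root_.Function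
open NumberField IsDedekindDomain

namespace Literature.NumberTheory.Automorphic

/-! ## § 1. `T(𝔸) = U(W₁)(𝔸) × U(W₂)(𝔸)` and `T(K) = U(W₁)(K) × U(W₂)(K)` -/

/-- **The seesaw torus, adelic points**: `T(𝔸) := U(W₁)(𝔸_K) × U(W₂)(𝔸_K)` for two hermitian lines `W₁, W₂` over
`L/K` (`U(W_j) = U(1)_{L/K}` canonically), a type synonym carrying the product group structure and topology and the
Borel σ-algebra. [folklore] -/
def SeesawTorus (K L : Type) [Field K] [Field L] [NumberField L] [Algebra K L] [FiniteDimensional K L] : Type :=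
  relNormOneIdeles K L × relNormOneIdeles K L

namespace SeesawTorus

section Group

variable (K L : Type) [Field K] [Field L] [NumberField L] [Algebra K L] [FiniteDimensional K L]

/-- Structure transported from the product (instance). [folklore] -/
instance instCommGroup : CommGroup (SeesawTorus K L) :=
  inferInstanceAs (CommGroup (relNormOneIdeles K L × relNormOneIdeles K L))

/-- Structure transported from the product (instance). [folklore] -/
instance instTopologicalSpace : TopologicalSpace (SeesawTorus K L) :=
  inferInstanceAs (TopologicalSpace (relNormOneIdeles K L × relNormOneIdeles K L))

/-- Structure transported from the product (instance). [folklore] -/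
instance instIsTopologicalGroup : IsTopologicalGroup (SeesawTorus K L) :=
  inferInstanceAs (IsTopologicalGroup (relNormOneIdeles K L × relNormOneIdeles K L))

/-- Structure transported from the product (instance). [folklore] -/
instance instT2Space : T2Space (SeesawTorus K L) :=
  inferInstanceAs (T2Space (relNormOneIdeles K L × relNormOneIdeles K L))

/-- The Borel σ-algebra on `T(𝔸)`. [folklore] -/
instance instMeasurableSpace : MeasurableSpace (SeesawTorus K L) := borel _

/-- Structure transported from the product (instance). [folklore] -/
instance instBorelSpace : BorelSpace (SeesawTorus K L) := ⟨rfl⟩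

/-- Structure transported from the product (instance). [folklore] -/
instance instInhabited : Inhabited (SeesawTorus K L) := ⟨1⟩

/-- `(u₁, u₂) ∈ T(𝔸)`. [folklore] -/
def mk (u₁ u₂ : relNormOneIdeles K L) : SeesawTorus K L := (u₁, u₂)

/-- The projection `T(𝔸) → U(W₁)(𝔸)`. [folklore] -/
def fst : SeesawTorus K L →* relNormOneIdeles K L := MonoidHom.fst _ _

/-- The projection `T(𝔸) → U(W₂)(𝔸)`. [folklore] -/
def snd : SeesawTorus K L →* relNormOneIdeles K L := MonoidHom.snd _ _

/-- The inclusion `U(W₁)(𝔸) → T(𝔸)`, `u ↦ (u, 1)`. [folklore] -/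
def inl : relNormOneIdeles K L →* SeesawTorus K L := MonoidHom.inl _ _

/-- The inclusion `U(W₂)(𝔸) → T(𝔸)`, `u ↦ (1, u)`. [folklore] -/
def inr : relNormOneIdeles K L →* SeesawTorus K L := MonoidHom.inr _ _

variable {K L}

/-- Evaluation rule for `fst_mk` (definitional up to the group laws). [folklore] -/
@[simp] theorem fst_mk (u₁ u₂ : relNormOneIdeles K L) : fst K L (mk K L u₁ u₂) = u₁ := rfl
/-- Evaluation rule for `snd_mk` (definitional up to the group laws). [folklore] -/
@[simp] theorem snd_mk (u₁ u₂ : relNormOneIdeles K L) : snd K L (mk K L u₁ u₂) = u₂ := rfl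
/-- Evaluation rule for `fst_inl` (definitional up to the group laws). [folklore] -/
@[simp] theorem fst_inl (u : relNormOneIdeles K L) : fst K L (inl K L u) = u := rfl
/-- Evaluation rule for `snd_inl` (definitional up to the group laws). [folklore] -/
@[simp] theorem snd_inl (u : relNormOneIdeles K L) : snd K L (inl K L u) = 1 := rfl
/-- Evaluation rule for `fst_inr` (definitional up to the group laws). [folklore] -/
@[simp] theorem fst_inr (u : relNormOneIdeles K L) : fst K L (inr K L u) = 1 := rfl
/-- Evaluation rule for `snd_inr` (definitional up to the group laws). [folklore] -/
@[simp] theorem snd_inr (u : relNormOneIdeles K L) : snd K L (inr K L u) = u := rfl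

/-- `t = (t₁, t₂)`. [folklore] -/
theorem mk_eq_fst_snd (t : SeesawTorus K L) : mk K L (fst K L t) (snd K L t) = t := rfl

/-- `(u₁, 1) · (1, u₂) = (u₁, u₂)`. [folklore] -/
theorem inl_mul_inr (u₁ u₂ : relNormOneIdeles K L) : inl K L u₁ * inr K L u₂ = mk K L u₁ u₂ :=
  Prod.ext (mul_one u₁) (one_mul u₂)

/-- Extensionality by the two projections. [folklore] -/
theorem ext {t t' : SeesawTorus K L} (h₁ : fst K L t = fst K L t') (h₂ : snd K L t = snd K L t') : t = t' :=
  Prod.ext h₁ h₂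

variable (K L)

/-- Continuity of `fst`. [folklore] -/
theorem continuous_fst : Continuous (fst K L) := _root_.continuous_fst
/-- Continuity of `snd`. [folklore] -/
theorem continuous_snd : Continuous (snd K L) := _root_.continuous_snd
/-- Continuity of `inl`. [folklore] -/
theorem continuous_inl : Continuous (inl K L) := continuous_id.prodMk continuous_const
/-- Continuity of `inr`. [folklore] -/
theorem continuous_inr : Continuous (inr K L) := continuous_const.prodMk continuous_id

/-- **`T(K) = U(W₁)(K) × U(W₂)(K)`**, the rational points. [folklore] -/
def rat : Subgroup (SeesawTorus K L) := (relNormOneRat K L).prod (relNormOneRat K L)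

variable {K L} in
/-- Membership in `T(K)` (definitional). [folklore] -/
theorem mem_rat_iff (t : SeesawTorus K L) :
    t ∈ rat K L ↔ fst K L t ∈ relNormOneRat K L ∧ snd K L t ∈ relNormOneRat K L :=
  Iff.rfl

/-- `T(K) → U(W₁)(K) × U(W₂)(K)` (used to transport discreteness). [folklore] -/
def ratToProd (a : rat K L) : relNormOneRat K L × relNormOneRat K L :=
  (⟨fst K L (a : SeesawTorus K L), a.2.1⟩, ⟨snd K L (a : SeesawTorus K L), a.2.2⟩)

/-- Injectivity of `ratToProd`. [folklore] -/
theorem ratToProd_injective : Injective (ratToProd K L) := by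
  intro a b h
  obtain ⟨h1, h2⟩ := Prod.mk.inj h
  exact Subtype.ext (ext (congrArg Subtype.val h1) (congrArg Subtype.val h2))

/-- Continuity of `ratToProd`. [folklore] -/
theorem continuous_ratToProd : Continuous (ratToProd K L) :=
  (((continuous_fst K L).comp continuous_subtype_val).subtype_mk _).prodMk
    (((continuous_snd K L).comp continuous_subtype_val).subtype_mk _)

/-- **`T(K)` is discrete in `T(𝔸)`**. [cite: CasselsFrohlichANT1967, Ch. II §14] -/
instance discreteTopology_rat : DiscreteTopology (rat K L) :=
  DiscreteTopology.of_continuous_injective (continuous_ratToProd K L) (ratToProd_injective K L)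

/-- `T(K)` is closed in `T(𝔸)`. [folklore] -/
theorem isClosed_rat : IsClosed (rat K L : Set (SeesawTorus K L)) := Subgroup.isClosed_of_discrete

/-- `T(𝔸)` is locally compact. [folklore] -/
instance instLocallyCompactSpace [NumberField K] : LocallyCompactSpace (SeesawTorus K L) :=
  inferInstanceAs (LocallyCompactSpace (relNormOneIdeles K L × relNormOneIdeles K L))

end Group

/-! ## § 2. The automorphic quotient `[T] = T(K) \ T(𝔸)` and `[T] ≃ₜ* [U(W₁)] × [U(W₂)]` -/

section Quotient

variable (K L : Type) [Field K] [Field L] [NumberField L] [Algebra K L] [FiniteDimensional K L]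

/-- `[T]` is Hausdorff. [folklore] -/
instance t2Space_quot : T2Space (SeesawTorus K L ⧸ rat K L) := by
  haveI := isClosed_rat K L
  infer_instance

/-- The Borel σ-algebra on `[T]`. [folklore] -/
instance measurableSpace_quot : MeasurableSpace (SeesawTorus K L ⧸ rat K L) := borel _

/-- Structure transported from the product (instance). [folklore] -/
instance borelSpace_quot : BorelSpace (SeesawTorus K L ⧸ rat K L) := ⟨rfl⟩

/-- Structure transported from the product (instance). [folklore] -/
instance nonempty_quot : Nonempty (SeesawTorus K L ⧸ rat K L) := ⟨1⟩

/-- `[T] → [U(W₁)]`. [folklore] -/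
def quotFst : SeesawTorus K L ⧸ rat K L →* relNormOneIdeles K L ⧸ relNormOneRat K L :=
  QuotientGroup.map _ _ (fst K L) fun _ ht => ht.1

/-- `[T] → [U(W₂)]`. [folklore] -/
def quotSnd : SeesawTorus K L ⧸ rat K L →* relNormOneIdeles K L ⧸ relNormOneRat K L :=
  QuotientGroup.map _ _ (snd K L) fun _ ht => ht.2

/-- `[U(W₁)] → [T]`. [folklore] -/
def quotInl : relNormOneIdeles K L ⧸ relNormOneRat K L →* SeesawTorus K L ⧸ rat K L :=
  QuotientGroup.map _ _ (inl K L) fun _ ha => ⟨ha, one_mem _⟩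

/-- `[U(W₂)] → [T]`. [folklore] -/
def quotInr : relNormOneIdeles K L ⧸ relNormOneRat K L →* SeesawTorus K L ⧸ rat K L :=
  QuotientGroup.map _ _ (inr K L) fun _ ha => ⟨one_mem _, ha⟩

variable {K L}

/-- Evaluation rule for `quotFst_mk` (definitional up to the group laws). [folklore] -/
@[simp] theorem quotFst_mk (t : SeesawTorus K L) :
    quotFst K L (QuotientGroup.mk t) = QuotientGroup.mk (fst K L t) := rfl
/-- Evaluation rule for `quotSnd_mk` (definitional up to the group laws). [folklore] -/
@[simp] theorem quotSnd_mk (t : SeesawTorus K L) :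
    quotSnd K L (QuotientGroup.mk t) = QuotientGroup.mk (snd K L t) := rfl
/-- Evaluation rule for `quotInl_mk` (definitional up to the group laws). [folklore] -/
@[simp] theorem quotInl_mk (u : relNormOneIdeles K L) :
    quotInl K L (QuotientGroup.mk u) = QuotientGroup.mk (inl K L u) := rfl
/-- Evaluation rule for `quotInr_mk` (definitional up to the group laws). [folklore] -/
@[simp] theorem quotInr_mk (u : relNormOneIdeles K L) :
    quotInr K L (QuotientGroup.mk u) = QuotientGroup.mk (inr K L u) := rfl

/-- Composition rule `quotFst_quotInl` for the structure maps of `[T]`. [folklore] -/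
@[simp] theorem quotFst_quotInl (q : relNormOneIdeles K L ⧸ relNormOneRat K L) :
    quotFst K L (quotInl K L q) = q := by
  induction q using QuotientGroup.induction_on; rfl
/-- Composition rule `quotSnd_quotInr` for the structure maps of `[T]`. [folklore] -/
@[simp] theorem quotSnd_quotInr (q : relNormOneIdeles K L ⧸ relNormOneRat K L) :
    quotSnd K L (quotInr K L q) = q := by
  induction q using QuotientGroup.induction_on; rfl
/-- Composition rule `quotSnd_quotInl` for the structure maps of `[T]`. [folklore] -/
@[simp] theorem quotSnd_quotInl (q : relNormOneIdeles K L ⧸ relNormOneRat K L) :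
    quotSnd K L (quotInl K L q) = 1 := by
  induction q using QuotientGroup.induction_on; rfl
/-- Composition rule `quotFst_quotInr` for the structure maps of `[T]`. [folklore] -/
@[simp] theorem quotFst_quotInr (q : relNormOneIdeles K L ⧸ relNormOneRat K L) :
    quotFst K L (quotInr K L q) = 1 := by
  induction q using QuotientGroup.induction_on; rfl

/-- `[(t₁, 1)] · [(1, t₂)] = [t]`. [folklore] -/
theorem quotInl_mul_quotInr (t : SeesawTorus K L) :
    quotInl K L (QuotientGroup.mk (fst K L t)) * quotInr K L (QuotientGroup.mk (snd K L t)) =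
      QuotientGroup.mk t := by
  rw [quotInl_mk, quotInr_mk, ← QuotientGroup.mk_mul, inl_mul_inr, mk_eq_fst_snd]

/-- Composition rule `quotInl_quotFst_mul_quotInr_quotSnd` for the structure maps of `[T]`. [folklore] -/
theorem quotInl_quotFst_mul_quotInr_quotSnd (q : SeesawTorus K L ⧸ rat K L) :
    quotInl K L (quotFst K L q) * quotInr K L (quotSnd K L q) = q := by
  induction q using QuotientGroup.induction_on
  exact quotInl_mul_quotInr _

variable (K L)

/-- Continuity of `quotFst`. [folklore] -/
theorem continuous_quotFst : Continuous (quotFst K L) :=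
  (QuotientGroup.isQuotientMap_mk _).continuous_iff.mpr (QuotientGroup.continuous_mk.comp (continuous_fst K L))
/-- Continuity of `quotSnd`. [folklore] -/
theorem continuous_quotSnd : Continuous (quotSnd K L) :=
  (QuotientGroup.isQuotientMap_mk _).continuous_iff.mpr (QuotientGroup.continuous_mk.comp (continuous_snd K L))
/-- Continuity of `quotInl`. [folklore] -/
theorem continuous_quotInl : Continuous (quotInl K L) :=
  (QuotientGroup.isQuotientMap_mk _).continuous_iff.mpr (QuotientGroup.continuous_mk.comp (continuous_inl K L))
/-- Continuity of `quotInr`. [folklore] -/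
theorem continuous_quotInr : Continuous (quotInr K L) :=
  (QuotientGroup.isQuotientMap_mk _).continuous_iff.mpr (QuotientGroup.continuous_mk.comp (continuous_inr K L))

/-- `[T] ≃* [U(W₁)] × [U(W₂)]` as groups. [folklore] -/
def quotMulEquiv : SeesawTorus K L ⧸ rat K L ≃*
    (relNormOneIdeles K L ⧸ relNormOneRat K L) × (relNormOneIdeles K L ⧸ relNormOneRat K L) where
  toFun q := (quotFst K L q, quotSnd K L q)
  invFun p := quotInl K L p.1 * quotInr K L p.2
  left_inv q := quotInl_quotFst_mul_quotInr_quotSnd q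
  right_inv p := by
    obtain ⟨p₁, p₂⟩ := p
    induction p₁ using QuotientGroup.induction_on with | H a => ?_
    induction p₂ using QuotientGroup.induction_on with | H b => ?_
    change (fun q => (quotFst K L q, quotSnd K L q))
      (quotInl K L (QuotientGroup.mk a) * quotInr K L (QuotientGroup.mk b)) = _
    rw [show quotInl K L (QuotientGroup.mk a) * quotInr K L (QuotientGroup.mk b) = QuotientGroup.mk (mk K L a b) from
      quotInl_mul_quotInr (mk K L a b)]
    rfl
  map_mul' q q' := by
    simp only [map_mul, Prod.mk_mul_mk]

/-- Evaluation rule for `quotMulEquiv_apply` (definitional up to the group laws). [folklore] -/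
@[simp] theorem quotMulEquiv_apply (q : SeesawTorus K L ⧸ rat K L) :
    quotMulEquiv K L q = (quotFst K L q, quotSnd K L q) := rfl

/-- Evaluation rule for `quotMulEquiv_symm_apply` (definitional up to the group laws). [folklore] -/
@[simp] theorem quotMulEquiv_symm_apply
    (p : (relNormOneIdeles K L ⧸ relNormOneRat K L) × (relNormOneIdeles K L ⧸ relNormOneRat K L)) :
    (quotMulEquiv K L).symm p = quotInl K L p.1 * quotInr K L p.2 := rfl

/-- Continuity of `quotMulEquiv`. [folklore] -/
theorem continuous_quotMulEquiv : Continuous (quotMulEquiv K L) :=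
  (continuous_quotFst K L).prodMk (continuous_quotSnd K L)

/-- Continuity of `quotMulEquiv_symm`. [folklore] -/
theorem continuous_quotMulEquiv_symm : Continuous (quotMulEquiv K L).symm :=
  ((continuous_quotInl K L).comp _root_.continuous_fst).mul ((continuous_quotInr K L).comp _root_.continuous_snd)

/-- **`[T] ≃ₜ* [U(W₁)] × [U(W₂)]`** as topological groups. [folklore] -/
def quotEquiv : SeesawTorus K L ⧸ rat K L ≃ₜ*
    (relNormOneIdeles K L ⧸ relNormOneRat K L) × (relNormOneIdeles K L ⧸ relNormOneRat K L) :=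
  { quotMulEquiv K L with
    continuous_toFun := continuous_quotMulEquiv K L
    continuous_invFun := continuous_quotMulEquiv_symm K L }

/-- Evaluation rule for `quotEquiv_apply` (definitional up to the group laws). [folklore] -/
@[simp] theorem quotEquiv_apply (q : SeesawTorus K L ⧸ rat K L) :
    quotEquiv K L q = (quotFst K L q, quotSnd K L q) := rfl

/-- Evaluation rule for `quotEquiv_mk` (definitional up to the group laws). [folklore] -/
theorem quotEquiv_mk (t : SeesawTorus K L) :
    quotEquiv K L (QuotientGroup.mk t) = (QuotientGroup.mk (fst K L t), QuotientGroup.mk (snd K L t)) := rfl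

/-- Evaluation rule for `quotEquiv_symm_apply` (definitional up to the group laws). [folklore] -/
@[simp] theorem quotEquiv_symm_apply
    (p : (relNormOneIdeles K L ⧸ relNormOneRat K L) × (relNormOneIdeles K L ⧸ relNormOneRat K L)) :
    (quotEquiv K L).symm p = quotInl K L p.1 * quotInr K L p.2 := rfl

variable [NumberField K]

/-- **`[T]` is compact** (anisotropic torus; here from `compactSpace_relNormOneQuot` for each factor).
[cite: PlatonovRapinchuk1994, §5.3] -/
instance compactSpace_quot : CompactSpace (SeesawTorus K L ⧸ rat K L) :=
  (quotEquiv K L).toHomeomorph.symm.compactSpace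

/-- `dt` on `[T]`: the Haar measure normalised by `vol [T] = 1`. [folklore] -/
def probHaarQuot : Measure (SeesawTorus K L ⧸ rat K L) := Measure.haarMeasure ⊤

/-- Structure transported from the product (instance). [folklore] -/
instance isHaarMeasure_probHaarQuot : (probHaarQuot K L).IsHaarMeasure := by
  unfold probHaarQuot; infer_instance

/-- Structure transported from the product (instance). [folklore] -/
instance isProbabilityMeasure_probHaarQuot : IsProbabilityMeasure (probHaarQuot K L) := by
  refine ⟨?_⟩
  have h := Measure.haarMeasure_self (G := SeesawTorus K L ⧸ rat K L) (K₀ := ⊤)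
  rwa [TopologicalSpace.PositiveCompacts.coe_top] at h

/-- Structure transported from the product (instance). [folklore] -/
instance isOpenPosMeasure_probHaarQuot : (probHaarQuot K L).IsOpenPosMeasure := inferInstance

/-- Structure transported from the product (instance). [folklore] -/
instance isMulLeftInvariant_probHaarQuot : (probHaarQuot K L).IsMulLeftInvariant := inferInstance

/-- Structure transported from the product (instance). [folklore] -/
instance isMulRightInvariant_probHaarQuot : (probHaarQuot K L).IsMulRightInvariant := by
  refine ⟨fun g => ?_⟩
  rw [show (fun x : SeesawTorus K L ⧸ rat K L => x * g) = fun x => g * x from funext fun x => mul_comm x g]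
  exact map_mul_left_eq_self _ g

/-- Total mass one. [folklore] -/
theorem probHaarQuot_univ : probHaarQuot K L univ = 1 := measure_univ

/-- Uniqueness: `dt` is THE Haar probability measure on `[T]`. [folklore] -/
theorem eq_probHaarQuot (μ : Measure (SeesawTorus K L ⧸ rat K L)) [μ.IsHaarMeasure] [IsProbabilityMeasure μ] :
    μ = probHaarQuot K L :=
  Measure.isHaarMeasure_eq_of_isProbabilityMeasure _ _

/-- `ν_T`: a Haar measure on `T(𝔸)`. [folklore] -/
def haar : Measure (SeesawTorus K L) := Measure.haar

/-- Structure transported from the product (instance). [folklore] -/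
instance isHaarMeasure_haar : (haar K L).IsHaarMeasure := by
  unfold haar; infer_instance

/-- Structure transported from the product (instance). [folklore] -/
instance isMulRightInvariant_haar : (haar K L).IsMulRightInvariant := by
  refine ⟨fun g => ?_⟩
  rw [show (fun x : SeesawTorus K L => x * g) = fun x => g * x from funext fun x => mul_comm x g]
  exact map_mul_left_eq_self _ g

/-- Structure transported from the product (instance). [folklore] -/
instance isOpenPosMeasure_haar : (haar K L).IsOpenPosMeasure := inferInstance

/-- Structure transported from the product (instance). [folklore] -/
instance isFiniteMeasureOnCompacts_haar : IsFiniteMeasureOnCompacts (haar K L) := inferInstance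

end Quotient

end SeesawTorus

end Literature.NumberTheory.Automorphic

end
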